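import Literature.NumberTheory.GaloisRepresentations.WeakAbelianDirectSummandRatLocAlgProofs
import Literature.NumberTheory.GaloisRepresentations.WeakAbelianDirectSummandRatCyclotomicProofs
import HarnessLib

/-!
# Böckle–Hui Thm. 2.2 over `ℚ` in the tree's idelic rendering, for an arbitrary idelic avatar (proved)

Topic `NumberTheory/GaloisRepresentations`; namespace
`Literature.NumberTheory.GaloisRepresentations`.  A *proofs* file (theorems only; no definition,
no named fact, no instance).

`WeakAbelianDirectSummandOfThm22Proofs.lean` proves Böckle–Hui's Thm. 1.1 for characters over any
number field from the hypothesis `h22` — BH Thm. 2.2 (Waldschmidt/Henniart: an `ℓ`-adic character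
with algebraic Frobenius values is almost locally algebraic) rendered idelically: for EVERY idelic
avatar `Ψ = ψ ∘ Art_K` of `ψ` and `L = S_ℓ`, some `(∏_{v∈L} Ψ(⟨k⟩_v))^N = ∏_τ τ(k)^{-n_τ}` holds for
`k ≡ 1 mod 𝔭_v^m` on `L`.  This file PROVES that statement for `K = ℚ`
(`pow_isLocallyAlgebraic_of_frobenius_isAlgebraic_rat`), for an arbitrary avatar `Ψ` — so the
rendering is consistent (sign conventions, normalisations) and the conditional theorem is the exact
generalisation of a proved one.  The proof is Serre's (*Abelian ℓ-adic representations*, Ch. III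
§1.2, §3, `K = ℚ`), as in the sibling `WeakAbelianDirectSummandRatLocAlgProofs`: the values
`Ψ(⟨q⟩_ℓ)` at primes `q` are algebraic (product formula,
`IdelicCharacter.isAlgebraic_prod_map_localUnits`, the Frobenius values being algebraic by
hypothesis), so the `ℓ`-adic six exponentials theorem (`exists_pow_eq_pow_of_isAlgebraic` over
`ℂ_ℓ`) gives `Ψ(⟨u⟩_ℓ)^b = u^a` on `ℤ_ℓˣ`, i.e. the identity with `N = b`, `n ≡ -a`, `m = 1`.

## References

* [BockleHui2025] G. Böckle, C.-Y. Hui, Math. Ann. 393 (2025), Thm. 2.2, §2.3.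
* [SerreAbelianLadic1968] J.-P. Serre, Ch. III §1.2 and §3 (the case `K = ℚ`).
-/

noncomputable section

open scoped NumberField Topology
open NumberField IsDedekindDomain IsDedekindDomain.HeightOneSpectrum Field Filter
open Rat.HeightOneSpectrum

namespace Literature.NumberTheory.GaloisRepresentations

namespace FramedGaloisRep

attribute [local instance] Rat.fact_prime_natGenerator

/-- **The local statement at the place of `ℓ`** (Serre III §3 over `ℚ`, for an arbitrary idelic
avatar): `Ψ(⟨u⟩_v)^b = u^a` on `𝒪_vˣ` for the place `v` of `ℚ` with `p_v = ℓ`, given the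
almost-everywhere local description of `Ψ` and algebraic Frobenius values of `ψ`.
[cite: SerreAbelianLadic1968, Ch. III §3 (Theorem, `K = ℚ`)] [cite: BockleHui2025, Theorem 2.2] -/
theorem exists_pow_map_localUnits_eq_pow_rat (v : HeightOneSpectrum (𝓞 ℚ))
    (ψ : FramedGaloisRep ℚ (PadicAlgCl (natGenerator v)) 1)
    (Ψ : ideleGroup ℚ →ₜ* (PadicAlgCl (natGenerator v))ˣ) (hK : ∀ x ∈ principalIdeles ℚ, Ψ x = 1)
    (hΨ : ∀ᶠ w : HeightOneSpectrum (𝓞 ℚ) in cofinite, ψ.IsUnramifiedAt w ∧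
      (∀ u : (w.adicCompletionIntegers ℚ)ˣ,
          Ψ (localUnits w (Units.map ((w.adicCompletionIntegers ℚ).subtype : _ →* _) u)) = 1) ∧
      ∀ ϖ : (w.adicCompletion ℚ)ˣ, Valued.v (ϖ : w.adicCompletion ℚ) = WithZero.exp (-1 : ℤ) →
        ψ.HasFrobCharpolyAt w (Polynomial.X - Polynomial.C ((Ψ (localUnits w ϖ) :
          (PadicAlgCl (natGenerator v))ˣ) : PadicAlgCl (natGenerator v))))
    (halg : ∀ᶠ w : HeightOneSpectrum (𝓞 ℚ) in cofinite, ψ.IsUnramifiedAt w ∧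
      ∀ 𝔓 ∈ w.primesAbove, ∀ σ : absoluteGaloisGroup ℚ, IsArithFrobAt (𝓞 ℚ) σ 𝔓 →
        IsAlgebraic ℚ ((((ψ σ : GL (Fin 1) (PadicAlgCl (natGenerator v))) :
          Matrix (Fin 1) (Fin 1) (PadicAlgCl (natGenerator v))) 0 0))) :
    ∃ b : ℕ, 0 < b ∧ ∃ a : ℤ, ∀ u : (v.adicCompletionIntegers ℚ)ˣ,
      ((Ψ (localUnits v (Units.map ((v.adicCompletionIntegers ℚ).subtype : _ →* _) u)) :
          (PadicAlgCl (natGenerator v))ˣ) : PadicAlgCl (natGenerator v)) ^ b =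
        (algebraMap ℚ_[natGenerator v] (PadicAlgCl (natGenerator v))
          (Rat.toPadic v ((u : v.adicCompletionIntegers ℚ) : v.adicCompletion ℚ))) ^ a := by
  classical
  set p : ℕ := natGenerator v with hp_def
  have hp : p.Prime := prime_natGenerator v
  have hpv : (p : 𝓞 ℚ) ∈ v.asIdeal := (Rat.natCast_mem_asIdeal_iff v).mpr dvd_rfl
  -- the exceptional set `S = {v} ∪ T ∪ T'`
  have hΨ' := hΨ
  have halg' := halg
  rw [Filter.eventually_cofinite] at hΨ' halg'
  set S : Finset (HeightOneSpectrum (𝓞 ℚ)) := {v} ∪ hΨ'.toFinset ∪ halg'.toFinset with hSdef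
  have hvS : v ∈ S := by simp [hSdef]
  -- unpacking the cofinite hypotheses at `w ∉ S`
  have hgoodΨ : ∀ w ∉ S, ψ.IsUnramifiedAt w ∧
      (∀ u : (w.adicCompletionIntegers ℚ)ˣ,
          Ψ (localUnits w (Units.map ((w.adicCompletionIntegers ℚ).subtype : _ →* _) u)) = 1) ∧
      ∀ ϖ : (w.adicCompletion ℚ)ˣ, Valued.v (ϖ : w.adicCompletion ℚ) = WithZero.exp (-1 : ℤ) →
        ψ.HasFrobCharpolyAt w (Polynomial.X - Polynomial.C ((Ψ (localUnits w ϖ) :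
          (PadicAlgCl p)ˣ) : PadicAlgCl p)) := by
    intro w hw
    by_contra hc
    exact hw (Finset.mem_union_left _ (Finset.mem_union_right _ (hΨ'.mem_toFinset.mpr hc)))
  have hgoodalg : ∀ w ∉ S, ψ.IsUnramifiedAt w ∧
      ∀ 𝔓 ∈ w.primesAbove, ∀ σ : absoluteGaloisGroup ℚ, IsArithFrobAt (𝓞 ℚ) σ 𝔓 →
        IsAlgebraic ℚ ((((ψ σ : GL (Fin 1) (PadicAlgCl p)) :
          Matrix (Fin 1) (Fin 1) (PadicAlgCl p)) 0 0)) := by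
    intro w hw
    by_contra hc
    exact hw (Finset.mem_union_right _ (halg'.mem_toFinset.mpr hc))
  have hS : ∀ w ∉ S, ∀ u : (w.adicCompletionIntegers ℚ)ˣ,
      Ψ (localUnits w (Units.map ((w.adicCompletionIntegers ℚ).subtype : _ →* _) u)) = 1 :=
    fun w hw => (hgoodΨ w hw).2.1
  have hfrob : ∀ w ∉ S, ∀ ϖ : (w.adicCompletion ℚ)ˣ,
      Valued.v (ϖ : w.adicCompletion ℚ) = WithZero.exp (-1 : ℤ) →
        ψ.HasFrobCharpolyAt w (Polynomial.X - Polynomial.C ((Ψ (localUnits w ϖ) :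
          (PadicAlgCl p)ˣ) : PadicAlgCl p)) :=
    fun w hw => (hgoodΨ w hw).2.2
  have halgw : ∀ w ∉ S, ∀ 𝔓 ∈ w.primesAbove, ∀ σ : absoluteGaloisGroup ℚ, IsArithFrobAt (𝓞 ℚ) σ 𝔓 →
      IsAlgebraic ℚ ((((ψ σ : GL (Fin 1) (PadicAlgCl p)) :
        Matrix (Fin 1) (Fin 1) (PadicAlgCl p)) 0 0)) :=
    fun w hw => (hgoodalg w hw).2
  -- algebraic Frobenius values of `Ψ`
  have halgΨ : ∀ w ∉ S, IsAlgebraic ℚ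
      ((Ψ (localUnits w (HeckeCharacter.uniformizer ℚ w)) : (PadicAlgCl p)ˣ) : PadicAlgCl p) := by
    intro w hw
    obtain ⟨𝔓, h𝔓⟩ := w.primesAbove_nonempty
    obtain ⟨Φ, hΦ⟩ := HeightOneSpectrum.exists_isArithFrobAt_of_mem_primesAbove_holds h𝔓
    have h1 := (hasFrobCharpolyAt_iff_of_rank_one ψ w _).mp
      (hfrob w hw _ (HeckeCharacter.valued_uniformizer w)) 𝔓 h𝔓 Φ hΦ
    rw [← h1]
    exact halgw w hw 𝔓 h𝔓 Φ hΦ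
  have hiii : ∀ k : ℚˣ, (∀ w ∈ S, (p : 𝓞 ℚ) ∉ w.asIdeal → w.valuation ℚ (k : ℚ) = 1) →
      IsAlgebraic ℚ ((∏ w ∈ S.filter (fun w => (p : 𝓞 ℚ) ∈ w.asIdeal),
        Ψ (localUnits w (globalToLocalUnits w k)) : (PadicAlgCl p)ˣ) : PadicAlgCl p) :=
    fun k hk => IdelicCharacter.isAlgebraic_prod_map_localUnits Ψ hK S hS halgΨ k hk
  -- `S.filter (p ∈ ·) = {v}`
  have hfilter : S.filter (fun w => (p : 𝓞 ℚ) ∈ w.asIdeal) = {v} := by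
    ext w
    rw [Finset.mem_filter, Finset.mem_singleton]
    constructor
    · rintro ⟨-, hw⟩
      have hdvd : natGenerator w ∣ p := (Rat.natCast_mem_asIdeal_iff w).mp hw
      have heq : natGenerator w = p :=
        (Nat.prime_dvd_prime_iff_eq (prime_natGenerator w) hp).mp hdvd
      exact Rat.natGenerator_injective heq
    · rintro rfl
      exact ⟨hvS, hpv⟩
  -- the transport `ℤ_ℓˣ → 𝒪_vˣ` and the character `g` on `ℤ_ℓˣ` with values in `ℂ_ℓ`
  let eZ : v.adicCompletionIntegers ℚ ≃+* ℤ_[p] :=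
    (adicCompletionIntegers.padicIntEquiv v).toAlgEquiv.toRingEquiv
  have heZc : Continuous eZ.symm := (adicCompletionIntegers.padicIntEquiv v).symm.continuous
  have heZval : ∀ x : v.adicCompletionIntegers ℚ, ((eZ x : ℤ_[p]) : ℚ_[p]) =
      Rat.toPadic v (x : v.adicCompletion ℚ) := fun x => rfl
  set θ : ℤ_[p]ˣ →* (v.adicCompletionIntegers ℚ)ˣ := Units.map eZ.symm.toMonoidHom with hθ_def
  have hθc : Continuous θ := Continuous.units_map _ heZc
  have hθval : ∀ u : ℤ_[p]ˣ, ((θ u : (v.adicCompletionIntegers ℚ)ˣ) : v.adicCompletionIntegers ℚ) =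
      eZ.symm (u : ℤ_[p]) := fun u => rfl
  set ι : PadicAlgCl p →+* ℂ_[p] := algebraMap (PadicAlgCl p) ℂ_[p] with hι_def
  have hιc : Continuous ι := UniformSpace.Completion.continuous_coe (PadicAlgCl p)
  set φ : (v.adicCompletionIntegers ℚ)ˣ →* (PadicAlgCl p)ˣ :=
    Ψ.toMonoidHom.comp ((localUnits v).comp
      (Units.map ((v.adicCompletionIntegers ℚ).subtype : _ →* _))) with hφ_def
  have hφ : ∀ u, φ u = Ψ (localUnits v (Units.map ((v.adicCompletionIntegers ℚ).subtype :
      _ →* _) u)) := fun u => rfl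
  have hφc : Continuous φ := Ψ.continuous.comp (IdelicCharacter.continuous_localUnits_unitsMap v)
  set g₀ : ℤ_[p]ˣ →* ℂ_[p]ˣ := (Units.map (ι : PadicAlgCl p →* ℂ_[p])).comp (φ.comp θ)
    with hg₀_def
  have hg₀ : ∀ u, ((g₀ u : ℂ_[p]ˣ) : ℂ_[p]) = ι ((φ (θ u) : (PadicAlgCl p)ˣ) : PadicAlgCl p) :=
    fun u => rfl
  have hg₀c : Continuous g₀ := (Continuous.units_map _ hιc).comp (hφc.comp hθc)
  set g : ℤ_[p]ˣ →ₜ* ℂ_[p]ˣ := ⟨g₀, hg₀c⟩ with hg_def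
  have hg : ∀ u, ((g u : ℂ_[p]ˣ) : ℂ_[p]) = ι ((φ (θ u) : (PadicAlgCl p)ˣ) : PadicAlgCl p) :=
    fun u => rfl
  -- the exceptional primes
  set S' : Set ℕ := (fun w : HeightOneSpectrum (𝓞 ℚ) => natGenerator w) '' (S : Set _)
    with hS'_def
  have hS'fin : S'.Finite := S.finite_toSet.image _
  -- algebraic values at the good primes, and Serre's theorem for `K = ℚ`
  obtain ⟨b, hb, a, hba⟩ := exists_pow_eq_pow_of_isAlgebraic g hS'fin (by
    intro q hq hqS u hu
    have hq0 : (q : ℚ) ≠ 0 := Nat.cast_ne_zero.mpr hq.ne_zero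
    set k : ℚˣ := Units.mk0 (q : ℚ) hq0 with hk_def
    have hu' : (u : ℤ_[p]) = (q : ℤ_[p]) := by
      apply Subtype.ext
      rw [PadicInt.coe_natCast]
      exact hu
    have hθu : Units.map ((v.adicCompletionIntegers ℚ).subtype : _ →* _) (θ u) =
        globalToLocalUnits v k := by
      apply Units.ext
      rw [Units.coe_map, val_globalToLocalUnits, hk_def, Units.val_mk0, map_natCast]
      change (((θ u : (v.adicCompletionIntegers ℚ)ˣ) : v.adicCompletionIntegers ℚ) :
        v.adicCompletion ℚ) = _
      rw [hθval u, hu', map_natCast]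
      rfl
    have hkS : ∀ w ∈ S, (p : 𝓞 ℚ) ∉ w.asIdeal → w.valuation ℚ (k : ℚ) = 1 := by
      intro w hw _
      have hne : natGenerator w ≠ q := fun heq => hqS ⟨w, hw, heq⟩
      have hndvd : ¬ ((natGenerator w : ℤ) ∣ (q : ℤ)) := fun hd => by
        have hd' : natGenerator w ∣ q := by exact_mod_cast hd
        exact hne ((Nat.prime_dvd_prime_iff_eq (prime_natGenerator w) hq).mp hd')
      have := Rat.valuation_intCast_eq_one w hndvd
      rw [hk_def, Units.val_mk0]
      exact_mod_cast this
    have halgk := hiii k hkS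
    rw [hfilter, Finset.prod_singleton] at halgk
    rw [hg, hφ, hθu]
    exact isAlgebraic_int_map ι ((IsFractionRing.isAlgebraic_iff ℤ ℚ (PadicAlgCl p)).mpr halgk))
  refine ⟨b, hb, a, fun u => ?_⟩
  set u' : ℤ_[p]ˣ := Units.map eZ.toMonoidHom u with hu'_def
  have hθu' : θ u' = u := by
    apply Units.ext
    rw [hθval u', hu'_def, Units.coe_map]
    exact eZ.symm_apply_apply _
  have hu'val : ((u' : ℤ_[p]) : ℚ_[p]) =
      Rat.toPadic v ((u : v.adicCompletionIntegers ℚ) : v.adicCompletion ℚ) := heZval _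
  have h1 := hba u'
  rw [hg, hθu', hφ, ← map_pow, hu'val,
    IsScalarTower.algebraMap_apply ℚ_[p] (PadicAlgCl p) ℂ_[p], ← hι_def, ← map_zpow₀] at h1
  exact ι.injective h1

/-- **Böckle–Hui Thm. 2.2 over `ℚ`, in the idelic rendering of
`exists_heckeCharacter_of_weaklyDivides_of_thm22`, for an arbitrary idelic avatar** (the `K = ℚ`
instance of the hypothesis `h22` there): with `L = {(ℓ)}`, `N = b`, `n ≡ -a` and `m = 1`,
`(∏_{v∈L} Ψ(⟨k⟩_v))^N = ∏_τ τ(k)^{-n_τ}` for every `k ∈ ℚˣ` with `|k - 1|_ℓ ≤ |ℓ|`.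
[cite: BockleHui2025, Theorem 2.2 (case `K = ℚ`)] [cite: SerreAbelianLadic1968, Ch. III §3] -/
theorem pow_isLocallyAlgebraic_of_frobenius_isAlgebraic_rat (ℓ : ℕ) [Fact ℓ.Prime]
    (ψ : FramedGaloisRep ℚ (PadicAlgCl ℓ) 1) (Ψ : ideleGroup ℚ →ₜ* (PadicAlgCl ℓ)ˣ)
    (hK : ∀ x ∈ principalIdeles ℚ, Ψ x = 1)
    (hΨ : ∀ᶠ v : HeightOneSpectrum (𝓞 ℚ) in cofinite, ψ.IsUnramifiedAt v ∧
      (∀ u : (v.adicCompletionIntegers ℚ)ˣ,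
          Ψ (localUnits v (Units.map ((v.adicCompletionIntegers ℚ).subtype : _ →* _) u)) = 1) ∧
      ∀ ϖ : (v.adicCompletion ℚ)ˣ, Valued.v (ϖ : v.adicCompletion ℚ) = WithZero.exp (-1 : ℤ) →
        ψ.HasFrobCharpolyAt v
          (Polynomial.X - Polynomial.C ((Ψ (localUnits v ϖ) : (PadicAlgCl ℓ)ˣ) : PadicAlgCl ℓ)))
    (halg : ∀ᶠ v : HeightOneSpectrum (𝓞 ℚ) in cofinite, ψ.IsUnramifiedAt v ∧
      ∀ 𝔓 ∈ v.primesAbove, ∀ σ : absoluteGaloisGroup ℚ, IsArithFrobAt (𝓞 ℚ) σ 𝔓 →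
        IsAlgebraic ℚ ((((ψ σ : GL (Fin 1) (PadicAlgCl ℓ)) :
          Matrix (Fin 1) (Fin 1) (PadicAlgCl ℓ)) 0 0)))
    (L : Finset (HeightOneSpectrum (𝓞 ℚ))) (hL : ∀ v, v ∈ L ↔ (ℓ : 𝓞 ℚ) ∈ v.asIdeal) :
    ∃ N : ℕ, 0 < N ∧ ∃ (n : (ℚ →+* PadicAlgCl ℓ) → ℤ) (m : ℕ), ∀ k : ℚˣ,
      (∀ v ∈ L, Valued.v (algebraMap ℚ (v.adicCompletion ℚ) (k : ℚ) - 1) ≤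
          WithZero.exp (-(m : ℤ))) →
      (∏ v ∈ L, ((Ψ (localUnits v (globalToLocalUnits v k)) : (PadicAlgCl ℓ)ˣ) : PadicAlgCl ℓ)) ^ N =
        ∏ τ : ℚ →+* PadicAlgCl ℓ, τ (k : ℚ) ^ (-(n τ)) := by
  classical
  -- `ℓ = p_{v₀}`
  obtain ⟨v₀, hv₀⟩ : ∃ v₀ : HeightOneSpectrum (𝓞 ℚ), natGenerator v₀ = ℓ :=
    ⟨(primesEquiv (R := 𝓞 ℚ)).symm ⟨ℓ, Fact.out⟩,
      congrArg Subtype.val ((primesEquiv (R := 𝓞 ℚ)).apply_symm_apply ⟨ℓ, Fact.out⟩)⟩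
  subst hv₀
  -- `L = {v₀}`
  have hLeq : L = {v₀} := by
    ext w
    rw [hL w, Finset.mem_singleton, natCast_natGenerator_mem_asIdeal_iff]
  obtain ⟨b, hb, a, hloc⟩ := exists_pow_map_localUnits_eq_pow_rat v₀ ψ Ψ hK hΨ halg
  refine ⟨b, hb, fun _ => -a, 1, fun k hk => ?_⟩
  rw [hLeq, Finset.prod_singleton]
  have hk1 := hk v₀ (by rw [hLeq]; exact Finset.mem_singleton_self v₀)
  -- `k` is a local unit at `v₀`
  have hkval : Valued.v ((globalToLocalUnits v₀ k : ((v₀.adicCompletion ℚ))ˣ) : v₀.adicCompletion ℚ)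
      = 1 := by
    rw [val_globalToLocalUnits]
    have hlt : WithZero.exp (-((1 : ℕ) : ℤ)) < 1 := by
      rw [← WithZero.exp_zero, WithZero.exp_lt_exp]; omega
    have h2 := Valuation.map_one_add_of_lt Valued.v (hk1.trans_lt hlt)
    rwa [add_sub_cancel] at h2
  obtain ⟨u, hu⟩ := IdelicCharacter.exists_unitsMap_eq_of_valued_eq_one _ hkval
  have hucoe : ((u : v₀.adicCompletionIntegers ℚ) : v₀.adicCompletion ℚ) =
      algebraMap ℚ (v₀.adicCompletion ℚ) (k : ℚ) := by
    have := congrArg (fun w : (v₀.adicCompletion ℚ)ˣ => (w : v₀.adicCompletion ℚ)) hu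
    simpa using this
  -- left side: `Ψ(⟨k⟩_{v₀})^b = k^a`
  have hleft : ((Ψ (localUnits v₀ (globalToLocalUnits v₀ k)) : (PadicAlgCl (natGenerator v₀))ˣ) :
      PadicAlgCl (natGenerator v₀)) ^ b = ((k : ℚ) : PadicAlgCl (natGenerator v₀)) ^ a := by
    rw [← hu, hloc u, hucoe, Rat.toPadic_algebraMap, map_ratCast]
  -- right side: the unique `τ : ℚ → ℚ̄_ℓ`
  have hright : (∏ τ : ℚ →+* PadicAlgCl (natGenerator v₀), τ (k : ℚ) ^ (-(-a))) =
      ((k : ℚ) : PadicAlgCl (natGenerator v₀)) ^ a := by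
    have hτ : ∀ τ : ℚ →+* PadicAlgCl (natGenerator v₀), τ (k : ℚ) = ((k : ℚ) : PadicAlgCl _) :=
      fun τ => by rw [eq_ratCast τ]
    simp only [hτ, neg_neg, Finset.prod_const, Finset.card_univ]
    have hcard : Fintype.card (ℚ →+* PadicAlgCl (natGenerator v₀)) = 1 :=
      le_antisymm (Fintype.card_le_one_iff_subsingleton.mpr inferInstance)
        (Fintype.card_pos_iff.mpr ⟨Rat.castHom _⟩)
    rw [hcard, pow_one]
  rw [hleft, hright]

end FramedGaloisRep

end Literature.NumberTheory.GaloisRepresentations
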